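import Literature.MathematicalPhysics.QuantumManyBody.PeriodicKineticBudget

/-!
# Route BECInfDivCoherence — `LevyMassCondensation`: the uniform energy ceiling

Helper file (supports `stmt-AtomisticToContinuum-9117`). The Dyson–Lieb–Seiringer–Yngvason upper
bound for the periodic ground-state energy at small density, in the `v`-uniform form consumed by
the glue: for every range bound `R > 0` there is `ρ₁ > 0` such that for `0 < ρ < ρ₁` and all large
`N`, `E₀^per(v; N, (N/ρ)^{1/3}) ≤ 16πRρN` for EVERY potential `v` vanishing beyond `R` — by
monotonicity in the potential (`v ≤` hard core of radius `2R`) and [LSSY2005, Thm. 2.2 (2.14)] for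
the hard core (`a = 2R`), proved in the tree as `LSSY2005_upperBound_periodic_holds`. The proof is
that of `kinetic_le_of_minimiser_uniform` (`PeriodicKineticBudget.lean`) with the (possibly
non-existent) minimiser removed.

Reference: E. H. Lieb, R. Seiringer, J. P. Solovej, J. Yngvason, *The Mathematics of the Bose Gas
and its Condensation*, Birkhäuser 2005, Thm. 2.2 (2.14).
-/

noncomputable section

namespace Summit.AtomisticToContinuum.BoseEinsteinCondensation.Theorems.InfDivGlue

open MeasureTheory Filter Literature.MathematicalPhysics.QuantumManyBody.BoseGas
open scoped ENNReal

/-- **Uniform energy ceiling at small density** (Dyson–LSSY upper bound through the hard core of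
radius `2R`): for every `R > 0` there is `ρ₁ > 0` such that for `0 < ρ < ρ₁` and all large `N`,
`E₀^per(v; N, (N/ρ)^{1/3}) ≤ 16πRρN` for every potential `v` vanishing beyond `R`.
(Adapted from `kinetic_le_of_minimiser_uniform`.) [cite: LSSY2005, Thm. 2.2 (2.14)] -/
theorem periodicGroundStateEnergy_le_uniform {R : ℝ} (hR : 0 < R) :
    ∃ ρ₁ : ℝ, 0 < ρ₁ ∧ ∀ ρ : ℝ, 0 < ρ → ρ < ρ₁ → ∀ᶠ N : ℕ in atTop,
      ∀ v : ℝ → ℝ≥0∞, (∀ r, R < r → v r = 0) →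
        periodicGroundStateEnergy v N (sideLength ρ N) ≤
          ENNReal.ofReal (16 * Real.pi * R * ρ * N) := by
  set w : ℝ → ℝ≥0∞ := hardCorePotential (2 * R) with hw
  have hwr : ∀ r, 2 * R < r → w r = 0 := fun r hr => hardCorePotential_of_le hr.le
  have haw : scatteringLength w = ENNReal.ofReal (2 * R) := scatteringLength_hardCorePotential _
  obtain ⟨C, c, hC, hc, H⟩ := LSSY2005_upperBound_periodic_holds w (2 * R)
    (measurable_hardCorePotential _) hwr (by rw [haw]; exact ENNReal.ofReal_ne_top)
  have ha : (scatteringLength w).toReal = 2 * R := by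
    rw [haw, ENNReal.toReal_ofReal (by linarith)]
  -- the smallness threshold
  set c' : ℝ := min c (1 / C) with hc'
  have hc'pos : 0 < c' := lt_min hc (by positivity)
  set ρ₁ : ℝ := 3 * (c' / (2 * R)) ^ 3 / (4 * Real.pi) with hρ₁
  have hρ₁pos : 0 < ρ₁ := by positivity
  refine ⟨ρ₁, hρ₁pos, fun ρ hρ hρlt => ?_⟩
  filter_upwards [eventually_ge_atTop 2,
    (tendsto_sideLength_atTop hρ).eventually_gt_atTop (2 * (2 * R))] with N hN2 hLR v hvR
  have hN0 : 0 < N := by omega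
  have hL : 0 < sideLength ρ N := by
    unfold sideLength; exact Real.rpow_pos_of_pos (div_pos (by exact_mod_cast hN0) hρ) _
  have hρL : (N : ℝ) / sideLength ρ N ^ 3 = ρ := div_sideLength_pow_three hρ hN0
  generalize sideLength ρ N = L at hL hρL hLR ⊢
  -- the effective density `ρ₁' = (N-1)/L³ ≤ ρ`
  set ρe : ℝ := ((N : ℝ) - 1) / L ^ 3 with hρe
  have hρe_le : ρe ≤ ρ := by
    rw [hρe, ← hρL]
    exact div_le_div_of_nonneg_right (by linarith) (by positivity)
  have hρe_pos : 0 < ρe := by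
    rw [hρe]
    have : (2 : ℝ) ≤ N := by exact_mod_cast hN2
    exact div_pos (by linarith) (by positivity)
  have hx_pos : 0 < 4 * Real.pi * ρe / 3 := by positivity
  -- `a/b = 2R (4πρe/3)^{1/3} ≤ 2R (4πρ/3)^{1/3} < c'`
  have hab_eq : (2 * R) / (4 * Real.pi * ρe / 3) ^ (-(1 : ℝ) / 3) =
      2 * R * (4 * Real.pi * ρe / 3) ^ ((1 : ℝ) / 3) := by
    rw [show (-(1 : ℝ) / 3) = -(1 / 3) by norm_num, Real.rpow_neg hx_pos.le, div_inv_eq_mul]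
  have hab_lt : 2 * R * (4 * Real.pi * ρe / 3) ^ ((1 : ℝ) / 3) < c' := by
    have h1 : (4 * Real.pi * ρe / 3) ^ ((1 : ℝ) / 3) ≤ (4 * Real.pi * ρ / 3) ^ ((1 : ℝ) / 3) :=
      Real.rpow_le_rpow hx_pos.le (by gcongr) (by norm_num)
    have h2 : (4 * Real.pi * ρ / 3) ^ ((1 : ℝ) / 3) < (4 * Real.pi * ρ₁ / 3) ^ ((1 : ℝ) / 3) :=
      Real.rpow_lt_rpow (by positivity) (by gcongr) (by norm_num)
    have h3 : (4 * Real.pi * ρ₁ / 3) ^ ((1 : ℝ) / 3) = c' / (2 * R) := by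
      rw [hρ₁]
      have : 4 * Real.pi * (3 * (c' / (2 * R)) ^ 3 / (4 * Real.pi)) / 3 = (c' / (2 * R)) ^ 3 := by
        field_simp
      rw [this, show ((1 : ℝ) / 3) = ((3 : ℕ) : ℝ)⁻¹ by norm_num,
        Real.pow_rpow_inv_natCast (by positivity) three_ne_zero]
    calc 2 * R * (4 * Real.pi * ρe / 3) ^ ((1 : ℝ) / 3)
        < 2 * R * (c' / (2 * R)) := by
          apply mul_lt_mul_of_pos_left (h1.trans_lt (h2.trans_eq h3)) (by linarith)
      _ = c' := by field_simp
  have hab_c : (2 * R) / (4 * Real.pi * ρe / 3) ^ (-(1 : ℝ) / 3) ≤ c := by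
    rw [hab_eq]; exact (hab_lt.le.trans (min_le_left _ _))
  have hab_C : C * ((2 * R) / (4 * Real.pi * ρe / 3) ^ (-(1 : ℝ) / 3)) ≤ 1 := by
    rw [hab_eq]
    have h1 : 2 * R * (4 * Real.pi * ρe / 3) ^ ((1 : ℝ) / 3) ≤ 1 / C :=
      hab_lt.le.trans (min_le_right _ _)
    calc C * (2 * R * (4 * Real.pi * ρe / 3) ^ ((1 : ℝ) / 3)) ≤ C * (1 / C) :=
          mul_le_mul_of_nonneg_left h1 hC.le
      _ = 1 := by field_simp
  -- apply Thm. 2.2 to the hard core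
  have hU := H N L hN2 hL (by linarith)
  simp only at hU
  rw [ha] at hU
  have hU' := hU hab_c
  calc periodicGroundStateEnergy v N L
      ≤ periodicGroundStateEnergy w N L :=
        periodicGroundStateEnergy_mono_of_le (le_hardCorePotential_two_mul hR hvR)
    _ ≤ ENNReal.ofReal (4 * Real.pi * ρe * (2 * R) *
          (1 + C * ((2 * R) / (4 * Real.pi * ρe / 3) ^ (-(1 : ℝ) / 3))) * N) := hU'
    _ ≤ ENNReal.ofReal (16 * Real.pi * R * ρ * N) := by
        apply ENNReal.ofReal_le_ofReal
        have hN' : (0 : ℝ) ≤ N := N.cast_nonneg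
        have h1 : 1 + C * ((2 * R) / (4 * Real.pi * ρe / 3) ^ (-(1 : ℝ) / 3)) ≤ 2 := by linarith
        have h0 : 0 ≤ 1 + C * ((2 * R) / (4 * Real.pi * ρe / 3) ^ (-(1 : ℝ) / 3)) := by
          rw [hab_eq]; positivity
        calc 4 * Real.pi * ρe * (2 * R) * (1 + C * ((2 * R) / (4 * Real.pi * ρe / 3) ^ (-(1 : ℝ) / 3))) * N
            ≤ 4 * Real.pi * ρ * (2 * R) * 2 * N := by
              gcongr
          _ = 16 * Real.pi * R * ρ * N := by ring

end Summit.AtomisticToContinuum.BoseEinsteinCondensation.Theorems.InfDivGlue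

end
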